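import Summits.QuantumFields.YangMills.Theorems.BalabanUVNodesN11AFibreDominationOnSupport

/-!
# DAG node N11 — A6 ∕ STRICTNESS EXHIBIT for the support-keyed coercivity row: a law-abiding 𝐓-residual whose `quad` is coercive ON THE SUPPORT OF ITS `ζ0`
# (so `…N11AFibreDominationOnSupport` §3∕§4 apply to it) and NOT coercive everywhere (so g0's `…N11AFibreDominationOfCoercive` §2∕§4 do not)

HEADER — WORK-UNIT METADATA.  Cell `pub-ymgap`, YM-PLAN Track A (HUMAN RULING D-0062 ∕ D-0149), WIDTH SEAT `pub-ymgap-dag-n11-w4` (g2) on NODE n11 [B14]; route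
`BalabanUVNodes` rev 25, item K1⁷ `StabilityBAtRecordR13SepCoPH` = stmt-QuantumFields-20542 (helper, `--kind proof --supports 20542 --as helper`, count-neutral).
Sibling of this seat's `…N11AFibreDominationOnSupport` (the row «coercivity of `quad_j` on the A-fibres through `supp ζ0_j`»), kept apart for size.
[III] = [Balaban1988Convergent], [I] = [Balaban1987RG1].

WHAT THIS FILE PROVES (0 `sorry`, 0 `def`; standard axioms).  For ANY background predicate `R_j` of the scale-`j` gauge component, the MODEL RESIDUAL
«`ζ0_j(Y)(ω) := 𝟙[R_j (ω j).1]`, `quad_j(Λ′)(ω) := 𝟙[R_j (ω j).1]·Σ_b ‖A_j(b)‖²`» (stated by its two defining equations — `model_exists`; NOT print's `𝒬_j`, a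
range witness): `model_laws` (the residual law `ζ0 ≥ 0`), ★ `model_coercive_on_support` (row (ii″) of the sibling's §4 with `c = 1`), ★ `model_not_coercive` (g0's
everywhere row (ii′) FAILS on a nonempty A-fibre as soon as one background fails `R_j`, `2 ≤ N`), ★ `model_afibre_dominated_on_support` (the sibling's §3 at the
model: its A-fibre domination row ON THE SUPPORT holds for every branch `S`).  Hence the sibling's hypothesis is STRICTLY weaker than g0's, with the regular set in
the picture (ref-M READ-30 T3).

HONEST FRAMING.  Helper lane of K1⁷; elementary bookkeeping; nothing of Bałaban's asserted; the model residual is NOT a law of record and NOT print's form.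
N11 NOT discharged; K1⁷ NOT closed; counts unmoved (typed 28∕28 · discharged 5∕27).  One finite four-torus programme at fixed `ε = L^{−K}`; R4 closes only the
conditional finite-𝕋⁴ rung `BalabanLadder.UV` — NOT ℝ⁴, NOT OS, NOT a mass gap, NOT Clay.  No `sorry`, `axiom`, `def`, `instance`, `notation`.
Sources (SHAPE only): [III] (2.21)–(2.22) p.258, p.267; [I] (2.11) p.267.
-/

noncomputable section

open MeasureTheory
open scoped BigOperators ENNReal NNReal

namespace Summit.QuantumFields.YangMills.Theorems.BalabanUVNodesN11AFibreDominationOnSupportModel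

open Literature.MathematicalPhysics.QuantumFieldTheory.Balaban1983to89 T4Continuum T4NestedCovariance T4AdjointCovariance Node00 Node00.Tk
open B10Eq42TorusConstraint (bondsIn)
open BalabanUVNodesN11AFibreDominationOnSupport (afibre_dominated_on_support_of_coercive_on_support)

/-! ## §1  The model residual: laws, coercivity on the support, failure of the everywhere row -/

section Model

variable {F : T4Family} {N : ℕ} {K : ℕ} (R : (j : ℕ) → GaugeField (F.P K) j (SU N) → Prop)

/-- **THE MODEL RESIDUAL KEYED BY A BACKGROUND PREDICATE `R` EXISTS** (stated by its two defining equations, no `def`): `ζ0_j(Y)(ω) := 𝟙[R_j (ω j).1]`,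
`quad_j(Λ′)(ω) := 𝟙[R_j (ω j).1]·Σ_b ‖A_j(b)‖²` — «the Gaussian is there exactly at the backgrounds `R` calls regular» (a range witness for §3∕§4's rows;
NOT print's `𝒬_j`). [cite: Balaban1988Convergent, (2.21) p.258 (bookkeeping)] -/
theorem model_exists : ∃ Z : TkResidualW F N (FluctV N) K,
    (∀ j Y ω, Z.ζ0 j Y ω = {ω : MultiCfg (F.P K) (SU N) (FluctV N) | R j (ω j).1}.indicator (fun _ => (1 : ℝ)) ω) ∧
    (∀ j Λ' ω, Z.quad j Λ' ω =
      {ω : MultiCfg (F.P K) (SU N) (FluctV N) | R j (ω j).1}.indicator (fun ω => ∑ b : PBond (F.P K) j, ‖(ω j).2 b‖ ^ 2) ω) :=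
  ⟨⟨fun j _ ω => {ω : MultiCfg (F.P K) (SU N) (FluctV N) | R j (ω j).1}.indicator (fun _ => (1 : ℝ)) ω,
    fun j _ ω => {ω : MultiCfg (F.P K) (SU N) (FluctV N) | R j (ω j).1}.indicator (fun ω => ∑ b : PBond (F.P K) j, ‖(ω j).2 b‖ ^ 2) ω⟩,
    fun _ _ _ => rfl, fun _ _ _ => rfl⟩

variable (Z : TkResidualW F N (FluctV N) K)
  (hζ0 : ∀ j Y ω, Z.ζ0 j Y ω = {ω : MultiCfg (F.P K) (SU N) (FluctV N) | R j (ω j).1}.indicator (fun _ => (1 : ℝ)) ω)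
  (hquad : ∀ j Λ' ω, Z.quad j Λ' ω =
    {ω : MultiCfg (F.P K) (SU N) (FluctV N) | R j (ω j).1}.indicator (fun ω => ∑ b : PBond (F.P K) j, ‖(ω j).2 b‖ ^ 2) ω)

include hζ0 in
/-- The model residual obeys the residual law `ζ0 ≥ 0`. [cite: Balaban1988Convergent, p.267 (bookkeeping)] -/
theorem model_laws : Z.Laws :=
  ⟨fun j Y ω => by rw [hζ0]; exact Set.indicator_nonneg (fun _ _ => zero_le_one) _⟩

include hζ0 hquad in
/-- **THE MODEL RESIDUAL IS COERCIVE ON THE SUPPORT OF ITS `ζ0`** (with `c = 1`, every `j`, all regions): §3∕§4's row (ii″) is inhabited by a law-abiding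
residual whose Gaussian is ABSENT off the `R`-regular backgrounds. [cite: Balaban1988Convergent, (2.21) p.258 (bookkeeping)] -/
theorem model_coercive_on_support (j : ℕ) (Λ' Y₀ Y : Set (Site (F.P K) 0)) :
    ∀ ω ω' : MultiCfg (F.P K) (SU N) (FluctV N), Z.ζ0 j Y₀ ω ≠ 0 → (∀ i, i ≠ j → ω' i = ω i) → (ω' j).1 = (ω j).1 →
      (∀ b, b ∉ bondsIn j Y → (ω' j).2 b = (ω j).2 b) →
      (1 : ℝ) * ∑ b ∈ (Set.toFinite (bondsIn j Y)).toFinset, ‖(ω' j).2 b‖ ^ 2 ≤ Z.quad j Λ' ω' := by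
  intro ω ω' hζ _ h2 _
  have hR : ω ∈ {ω : MultiCfg (F.P K) (SU N) (FluctV N) | R j (ω j).1} := by
    by_contra hnot
    rw [hζ0, Set.indicator_of_notMem hnot] at hζ
    exact hζ rfl
  have hR' : ω' ∈ {ω : MultiCfg (F.P K) (SU N) (FluctV N) | R j (ω j).1} := by
    show R j (ω' j).1
    rw [h2]
    exact hR
  rw [hquad, Set.indicator_of_mem hR', one_mul]
  exact Finset.sum_le_sum_of_subset_of_nonneg (Finset.subset_univ _) fun b _ _ => sq_nonneg _

include hquad in
/-- **… AND IS NOT COERCIVE EVERYWHERE** (`2 ≤ N`): on a nonempty A-fibre, as soon as ONE background fails `R_j`, g0's everywhere row (ii′) FAILS for the model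
residual — test it at that background with the constant fluctuation field `A_j ≡ v₀`, `‖v₀‖ = 1`: `c·|sA| ≤ 0`.  So §4's hypothesis is STRICTLY weaker than g0
§4's (ref-M READ-30 T3, now with the regular set in the picture). [cite: Balaban1988Convergent, (2.21)–(2.22) p.258 (bookkeeping)] -/
theorem model_not_coercive (hN : 2 ≤ N) (j : ℕ) (Λ' Y : Set (Site (F.P K) 0)) (hY : bondsIn j Y ≠ ∅)
    (hirr : ∃ ω₀ : MultiCfg (F.P K) (SU N) (FluctV N), ¬ R j (ω₀ j).1) :
    ¬ ∃ c : ℝ, 0 < c ∧ ∀ ω : MultiCfg (F.P K) (SU N) (FluctV N),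
      c * ∑ b ∈ (Set.toFinite (bondsIn j Y)).toFinset, ‖(ω j).2 b‖ ^ 2 ≤ Z.quad j Λ' ω := by
  rintro ⟨c, hc, h⟩
  obtain ⟨ω₀, hω₀⟩ := hirr
  obtain ⟨b₀, hb₀⟩ := Set.nonempty_iff_ne_empty.mpr hY
  -- a unit fluctuation vector (`N² − 1 ≥ 3` coordinates)
  have hdim : 0 < N ^ 2 - 1 := by
    have : 4 ≤ N ^ 2 := by nlinarith
    omega
  set v₀ : FluctV N := EuclideanSpace.single (⟨0, hdim⟩ : Fin (N ^ 2 - 1)) (1 : ℝ) with hv₀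
  have hv₀n : ‖v₀‖ = 1 := by rw [hv₀, PiLp.norm_single, norm_one]
  -- the irregular background with the constant fluctuation field `A_j ≡ v₀`
  set ωc : MultiCfg (F.P K) (SU N) (FluctV N) := Function.update ω₀ j ((ω₀ j).1, fun _ => v₀) with hωc
  have hωc1 : (ωc j).1 = (ω₀ j).1 := by rw [hωc, Function.update_self]
  have hωc2 : ∀ b, (ωc j).2 b = v₀ := fun b => by rw [hωc, Function.update_self]
  have hq : Z.quad j Λ' ωc = 0 := by
    rw [hquad]
    refine Set.indicator_of_notMem ?_ _
    show ¬ R j (ωc j).1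
    rw [hωc1]
    exact hω₀
  have hb₀' : b₀ ∈ (Set.toFinite (bondsIn j Y)).toFinset := (Set.Finite.mem_toFinset _).mpr hb₀
  have hpos : 0 < ∑ b ∈ (Set.toFinite (bondsIn j Y)).toFinset, ‖(ωc j).2 b‖ ^ 2 := by
    refine Finset.sum_pos' (fun b _ => sq_nonneg _) ⟨b₀, hb₀', ?_⟩
    rw [hωc2, hv₀n]; norm_num
  have hω := h ωc
  rw [hq] at hω
  have : 0 < c * ∑ b ∈ (Set.toFinite (bondsIn j Y)).toFinset, ‖(ωc j).2 b‖ ^ 2 := mul_pos hc hpos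
  linarith

end Model

/-! ## §2  The sibling's §3 row at the model residual -/

section Row

variable {F : T4Family} {N : ℕ} [NeZero N] (ν : Stage7Numerics) (A₁ : ℝ) (p : B12.RunParams) (g : ℕ → ℝ)
  (R : (j : ℕ) → GaugeField (F.P p.K) j (SU N) → Prop) (Z : TkResidualW F N (FluctV N) p.K)
  (hζ0 : ∀ j Y ω, Z.ζ0 j Y ω = {ω : MultiCfg (F.P p.K) (SU N) (FluctV N) | R j (ω j).1}.indicator (fun _ => (1 : ℝ)) ω)
  (hquad : ∀ j Λ' ω, Z.quad j Λ' ω =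
    {ω : MultiCfg (F.P p.K) (SU N) (FluctV N) | R j (ω j).1}.indicator (fun ω => ∑ b : PBond (F.P p.K) j, ‖(ω j).2 b‖ ^ 2) ω)

include hζ0 hquad in
/-- **★ THE SIBLING's §3 ROW IS INHABITED AT THE MODEL RESIDUAL** (A6): for 12a″'s weights over the model residual and EVERY branch `S`, each generation's A-fibre
weight is dominated ON THE A-FIBRES THROUGH `supp ζ0_j(Y₀)` by an integrable function of the integrated variables — although the everywhere row fails for it
(`model_not_coercive`). [cite: Balaban1988Convergent, (2.21) p.258, (3.21) p.269 (bookkeeping)] -/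
theorem model_afibre_dominated_on_support (j : ℕ) (Λ' Y₀ Y S : Set (Site (F.P p.K) 0)) :
    ∃ ŵ : (↥(Set.toFinite (bondsIn j Y)).toFinset → FluctV N) → ℝ≥0∞, Measurable ŵ ∧
      (∫⁻ a, ŵ a ∂(Measure.pi fun _ : ↥(Set.toFinite (bondsIn j Y)).toFinset => (volume : Measure (FluctV N)))) ≠ ⊤ ∧
      ∀ ω ω' : MultiCfg (F.P p.K) (SU N) (FluctV N), Z.ζ0 j Y₀ ω ≠ 0 → (∀ i, i ≠ j → ω' i = ω i) → (ω' j).1 = (ω j).1 →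
        (∀ b, b ∉ bondsIn j Y → (ω' j).2 b = (ω j).2 b) →
        ENNReal.ofReal ((tkWeightsOfRecordP F N (FluctV N) ν A₁ p g Z).w j Λ' Y S ω') ≤
          ŵ (fun b : ↥(Set.toFinite (bondsIn j Y)).toFinset => (ω' j).2 b) :=
  afibre_dominated_on_support_of_coercive_on_support ν A₁ p g Z j Λ' Y₀ Y S one_pos (model_coercive_on_support R Z hζ0 hquad j Λ' Y₀ Y)

end Row

end Summit.QuantumFields.YangMills.Theorems.BalabanUVNodesN11AFibreDominationOnSupportModel

end
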